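import Summits.Ventures.HodgeRepro2.T5CyclotomicSevenHeckeCommutative
import Mathlib.NumberTheory.NumberField.Cyclotomic.Galois

/-!
# FOR EVERY ODD PRIME `ℓ`: a place of `ℚ(ζ_ℓ)⁺` above `p ≠ ℓ` stays prime in `ℚ(ζ_ℓ)` iff the order of `p` modulo
# `ℓ` is EVEN — the decomposition group of `P ∣ p` is `⟨p⟩ ⊂ (ℤ/ℓ)ˣ` and complex conjugation is `−1`

Tier-5 support N3 / §G-N4.2 (seat p3, gen 79). File 266's census of `ℚ(ζ₇)` used the accident `[ℚ(ζ₇)⁺ : ℚ] = 3`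
(a divisibility argument). The general criterion is a decomposition-group statement, in kernel here for EVERY odd prime
`ℓ`, `K = ℚ(ζ_ℓ)`, `K⁺ = maximalRealSubfield K`: Mathlib's `IsCyclotomicExtension.Rat.galEquivZMod_stabilizer`
identifies the stabiliser of a prime `P ∣ p` in `Gal(K/ℚ) ≃ (ℤ/ℓ)ˣ` with the subgroup generated by `p`; complex
conjugation `c` is the element `−1` (it inverts `ζ_ℓ`); `−1 ∈ ⟨p⟩` iff `orderOf p` is even (the unique element of
order `2` of the cyclic group `(ℤ/ℓ)ˣ`); and `c` fixes `P` iff `P` is the only prime above `v = P ∩ 𝓞_{K⁺}`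
(`Gal(K/K⁺) = {1, c}` acts transitively on the primes above `v`). Hence

* `neg_one_mem_zpowers_iff_even_orderOf` — in `(ℤ/ℓ)ˣ`, `−1 ∈ ⟨x⟩ ⟺ orderOf x` even;
* `complexConj_zeta`, **`galEquivZMod_complexConj_restrictScalars`** — `c ζ = ζ⁻¹`, `c ↦ −1`;
* **`complexConj_mem_stabilizer_iff`** — `c` fixes `P ∣ p` iff `orderOf (p mod ℓ)` is even;
* `primesOver_eq_pair`, `ncard_primesOver_eq_one_iff_smul_eq` — the primes above `v` are `{P, c • P}`;
* **`ncard_primesOver_eq_one_iff_even`**, **`exists_map_eq_iff_even`** — a place `v` of `ℚ(ζ_ℓ)⁺` above a prime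
  `p ≠ ℓ` stays prime in `ℚ(ζ_ℓ)` iff `orderOf (p mod ℓ)` is even; `ncard_primesOver_eq_two_iff_odd`.

§8(d): uses an L-value-free non-vanishing device: NO.
-/

open NumberField NumberField.IsCMField IsDedekindDomain IsDedekindDomain.HeightOneSpectrum Module Polynomial
  MulAction
open scoped Pointwise ComplexConjugate
open Summit.Ventures.HodgeRepro2.T5RecordSatakeInert Summit.Ventures.HodgeRepro2.T5FinitePlaceSplitIff
  Summit.Ventures.HodgeRepro2.T5FinitePlaceLocalDegree Summit.Ventures.HodgeRepro2.T5RecordSatakeIntrinsic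
  Summit.Ventures.HodgeRepro2.T5CyclotomicSevenHeckeCommutative

namespace Summit.Ventures.HodgeRepro2.T5CyclotomicStaysPrimeIffEven

section Units

variable (ℓ : ℕ) [hℓ : Fact ℓ.Prime]

/-- `−1 ≠ 1` in `(ℤ/ℓ)ˣ` for `ℓ > 2`. -/
theorem neg_one_ne_one_units (h2 : 2 < ℓ) : (-1 : (ZMod ℓ)ˣ) ≠ 1 := by
  intro h
  haveI : Fact (2 < ℓ) := ⟨h2⟩
  have h' : ((-1 : (ZMod ℓ)ˣ) : ZMod ℓ) = 1 := by rw [h, Units.val_one]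
  rw [Units.val_neg, Units.val_one] at h'
  exact ZMod.neg_one_ne_one h'

/-- **In `(ℤ/ℓ)ˣ`, `−1 ∈ ⟨x⟩` iff the order of `x` is even** (`ℓ > 2`): `x^{o/2}` is the unique element of order
`2`; conversely `x^k = −1` with `o` odd forces `x^k = 1`. -/
theorem neg_one_mem_zpowers_iff_even_orderOf (h2 : 2 < ℓ) (x : (ZMod ℓ)ˣ) :
    (-1 : (ZMod ℓ)ˣ) ∈ Subgroup.zpowers x ↔ Even (orderOf x) := by
  classical
  constructor
  · intro hmem
    rw [mem_zpowers_iff_mem_range_orderOf] at hmem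
    obtain ⟨k, -, hk⟩ := Finset.mem_image.mp hmem
    by_contra hodd
    rw [Nat.not_even_iff_odd] at hodd
    have h2k : x ^ (2 * k) = 1 := by rw [pow_mul', hk, neg_one_sq]
    have hcop : Nat.Coprime (orderOf x) 2 := Nat.coprime_two_right.mpr hodd
    have hk' : orderOf x ∣ k := hcop.dvd_of_dvd_mul_left (orderOf_dvd_of_pow_eq_one h2k)
    rw [orderOf_dvd_iff_pow_eq_one] at hk'
    rw [hk'] at hk
    exact neg_one_ne_one_units ℓ h2 hk.symm
  · intro heven
    obtain ⟨m, hm⟩ := heven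
    have hpos := orderOf_pos x
    have hm0 : 0 < m := by omega
    have hsq : (x ^ m) ^ 2 = 1 := by
      rw [← pow_mul, show m * 2 = orderOf x by omega, pow_orderOf_eq_one]
    have hne : x ^ m ≠ 1 := pow_ne_one_of_lt_orderOf hm0.ne' (by omega)
    have hval : ((x ^ m : (ZMod ℓ)ˣ) : ZMod ℓ) * ((x ^ m : (ZMod ℓ)ˣ) : ZMod ℓ) = 1 := by
      rw [← Units.val_mul, ← sq, hsq, Units.val_one]
    rcases mul_self_eq_one_iff.mp hval with h1 | h1
    · exact absurd (Units.ext (h1.trans Units.val_one.symm)) hne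
    · refine Subgroup.mem_zpowers_iff.mpr ⟨(m : ℤ), ?_⟩
      rw [zpow_natCast]
      refine Units.ext ?_
      rw [Units.val_neg, Units.val_one]
      exact h1

/-- The order of the unit `p mod ℓ` is the order of `p` in `ZMod ℓ`. -/
theorem orderOf_unitOfCoprime (p : ℕ) (hn : p.Coprime ℓ) :
    orderOf (ZMod.unitOfCoprime p hn) = orderOf (p : ZMod ℓ) := by
  rw [← orderOf_units, ZMod.coe_unitOfCoprime]

end Units

section Cyclotomic

variable (ℓ : ℕ) [hℓ : Fact ℓ.Prime] (h2 : 2 < ℓ)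
variable (K : Type*) [Field K] [CharZero K] [IsCyclotomicExtension {ℓ} ℚ K]

omit hℓ in
include ℓ in
/-- `ℚ(ζ_ℓ)` is a number field (as a theorem, to `haveI` inside statements). -/
theorem numberFieldCyc : NumberField K := IsCyclotomicExtension.numberField {ℓ} ℚ K

omit hℓ in
include h2 in
/-- `ℚ(ζ_ℓ)` is a CM field for `ℓ > 2` (Mathlib's `IsCyclotomicExtension.Rat.isCMField`). -/
theorem isCMFieldCyc : IsCMField K := IsCyclotomicExtension.Rat.isCMField K (S := {ℓ}) ⟨ℓ, rfl, h2⟩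

include h2 in
/-- **Complex conjugation inverts `ζ_ℓ`**: under any complex embedding `φ`, `φ ζ` has norm `1`, so
`conj (φ ζ) = (φ ζ)⁻¹`. -/
theorem complexConj_zeta :
    haveI := numberFieldCyc ℓ K; haveI := isCMFieldCyc ℓ h2 K
    complexConj K (IsCyclotomicExtension.zeta ℓ ℚ K) = (IsCyclotomicExtension.zeta ℓ ℚ K)⁻¹ := by
  haveI := numberFieldCyc ℓ K
  haveI := isCMFieldCyc ℓ h2 K
  have hζ := IsCyclotomicExtension.zeta_spec ℓ ℚ K
  let φ : K →+* ℂ := Classical.choice (inferInstance : Nonempty _)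
  apply φ.injective
  rw [complexEmbedding_complexConj, map_inv₀, Complex.inv_eq_conj]
  exact Complex.norm_eq_one_of_pow_eq_one (by rw [← map_pow, hζ.pow_eq_one, map_one]) hℓ.out.ne_zero

/-- `((ℓ - 1 : ℕ) : ZMod ℓ) = -1`. -/
theorem natCast_sub_one_eq_neg_one : ((ℓ - 1 : ℕ) : ZMod ℓ) = -1 := by
  have h : ((ℓ - 1 : ℕ) : ZMod ℓ) + 1 = 0 := by
    rw [← Nat.cast_add_one, Nat.sub_add_cancel hℓ.out.one_le, ZMod.natCast_self]
  exact eq_neg_of_add_eq_zero_left h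

include h2 in
/-- **Complex conjugation is `−1 ∈ (ℤ/ℓ)ˣ`** under Mathlib's `galEquivZMod` (`c ζ = ζ^a` with `a = −1 mod ℓ`). -/
theorem galEquivZMod_complexConj_restrictScalars :
    haveI := numberFieldCyc ℓ K; haveI := isCMFieldCyc ℓ h2 K
    IsCyclotomicExtension.Rat.galEquivZMod ℓ K ((complexConj K).restrictScalars ℚ) = -1 := by
  haveI := numberFieldCyc ℓ K
  haveI := isCMFieldCyc ℓ h2 K
  have hζ := IsCyclotomicExtension.zeta_spec ℓ ℚ K
  set ζ := IsCyclotomicExtension.zeta ℓ ℚ K with hζdef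
  have h1 := IsCyclotomicExtension.Rat.galEquivZMod_apply_of_pow_eq ℓ K ((complexConj K).restrictScalars ℚ)
    hζ.pow_eq_one
  rw [AlgEquiv.restrictScalars_apply, complexConj_zeta ℓ h2 K] at h1
  have hinv : ζ⁻¹ = ζ ^ (ℓ - 1) := by
    refine inv_eq_of_mul_eq_one_right ?_
    rw [← pow_succ', Nat.sub_add_cancel hℓ.out.one_le, hζ.pow_eq_one]
  rw [hinv] at h1
  have hval : (IsCyclotomicExtension.Rat.galEquivZMod ℓ K ((complexConj K).restrictScalars ℚ)).val.val = ℓ - 1 :=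
    hζ.pow_inj (ZMod.val_lt _) (Nat.sub_lt hℓ.out.pos one_pos) h1.symm
  refine Units.ext ?_
  rw [Units.val_neg, Units.val_one, ← ZMod.natCast_zmod_val
    (IsCyclotomicExtension.Rat.galEquivZMod ℓ K ((complexConj K).restrictScalars ℚ)).val, hval]
  exact natCast_sub_one_eq_neg_one ℓ

variable (p : ℕ) [hp : Fact p.Prime] (hn : p.Coprime ℓ)
variable (P : Ideal (𝓞 K)) [P.IsMaximal] [P.LiesOver (Ideal.span {(p : ℤ)})]

include h2 hn in
/-- **Complex conjugation fixes a prime `P ∣ p` iff `orderOf (p mod ℓ)` is even**: the stabiliser of `P` in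
`Gal(K/ℚ) ≃ (ℤ/ℓ)ˣ` is `⟨p⟩` (Mathlib's `galEquivZMod_stabilizer`), `c ↦ −1`, and `−1 ∈ ⟨p⟩` iff the order is even. -/
theorem complexConj_mem_stabilizer_iff :
    haveI := numberFieldCyc ℓ K; haveI := isCMFieldCyc ℓ h2 K
    (complexConj K).restrictScalars ℚ ∈ stabilizer (K ≃ₐ[ℚ] K) P ↔ Even (orderOf (p : ZMod ℓ)) := by
  haveI := numberFieldCyc ℓ K
  haveI := isCMFieldCyc ℓ h2 K
  have hst := IsCyclotomicExtension.Rat.galEquivZMod_stabilizer ℓ K p P hn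
  have key : (complexConj K).restrictScalars ℚ ∈ stabilizer (K ≃ₐ[ℚ] K) P ↔
      IsCyclotomicExtension.Rat.galEquivZMod ℓ K ((complexConj K).restrictScalars ℚ) ∈
        (IsCyclotomicExtension.Rat.galEquivZMod ℓ K).mapSubgroup (stabilizer (K ≃ₐ[ℚ] K) P) := by
    rw [MulEquiv.coe_mapSubgroup, Subgroup.mem_map_equiv, MulEquiv.symm_apply_apply]
  rw [key, hst, galEquivZMod_complexConj_restrictScalars ℓ h2 K, neg_one_mem_zpowers_iff_even_orderOf ℓ h2,
    orderOf_unitOfCoprime ℓ p hn]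

end Cyclotomic

section Primes

variable (ℓ : ℕ) [hℓ : Fact ℓ.Prime] (h2 : 2 < ℓ)
variable (K : Type*) [Field K] [CharZero K] [IsCyclotomicExtension {ℓ} ℚ K]
variable (v : HeightOneSpectrum (𝓞 (maximalRealSubfield K))) (P : Ideal (𝓞 K)) [hP : P.IsPrime]
  [hPv : P.LiesOver v.asIdeal]

omit hℓ in
include h2 in
/-- The image of a prime above `v` under an element of `Gal(K/K⁺)` is a prime above `v`. -/
theorem smul_mem_primesOver (σ : K ≃ₐ[maximalRealSubfield K] K) :
    haveI := numberFieldCyc ℓ K; haveI := isCMFieldCyc ℓ h2 K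
    σ • P ∈ v.asIdeal.primesOver (𝓞 K) := by
  haveI := numberFieldCyc ℓ K
  haveI := isCMFieldCyc ℓ h2 K
  exact ⟨Ideal.IsPrime.smul σ, Ideal.LiesOver.smul σ⟩

omit hℓ in
include h2 in
/-- Every element of `Gal(K/K⁺)` is `1` or complex conjugation. -/
theorem eq_one_or_eq_complexConj (σ : K ≃ₐ[maximalRealSubfield K] K) :
    haveI := numberFieldCyc ℓ K; haveI := isCMFieldCyc ℓ h2 K
    σ = 1 ∨ σ = complexConj K := by
  haveI := numberFieldCyc ℓ K
  haveI := isCMFieldCyc ℓ h2 K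
  classical
  have hmem : σ ∈ Subgroup.zpowers (complexConj K) := by
    rw [zpowers_complexConj_eq_top]
    exact Subgroup.mem_top σ
  rw [mem_zpowers_iff_mem_range_orderOf, orderOf_complexConj] at hmem
  obtain ⟨k, hk, rfl⟩ := Finset.mem_image.mp hmem
  rw [Finset.mem_range] at hk
  interval_cases k
  · exact Or.inl (pow_zero _)
  · exact Or.inr (pow_one _)

omit hℓ in
include h2 in
/-- **The primes of `ℚ(ζ_ℓ)` above `v` are `P` and `c • P`** (`Gal(K/K⁺) = {1, c}` acts transitively). -/
theorem primesOver_eq_pair :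
    haveI := numberFieldCyc ℓ K; haveI := isCMFieldCyc ℓ h2 K
    v.asIdeal.primesOver (𝓞 K) = {P, complexConj K • P} := by
  haveI := numberFieldCyc ℓ K
  haveI := isCMFieldCyc ℓ h2 K
  ext Q
  constructor
  · intro hQ
    haveI := hQ.1
    haveI := hQ.2
    obtain ⟨σ, hσ⟩ := Ideal.exists_smul_eq_of_isGaloisGroup v.asIdeal P Q (K ≃ₐ[maximalRealSubfield K] K)
    rcases eq_one_or_eq_complexConj ℓ h2 K σ with h | h
    · rw [h, one_smul] at hσ
      exact Or.inl hσ.symm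
    · rw [h] at hσ
      exact Or.inr hσ.symm
  · rintro (rfl | rfl)
    · exact ⟨hP, hPv⟩
    · exact smul_mem_primesOver ℓ h2 K v P (complexConj K)

omit hℓ in
include h2 in
/-- **One prime above `v` iff complex conjugation fixes `P`.** -/
theorem ncard_primesOver_eq_one_iff_smul_eq :
    haveI := numberFieldCyc ℓ K; haveI := isCMFieldCyc ℓ h2 K
    (v.asIdeal.primesOver (𝓞 K)).ncard = 1 ↔ complexConj K • P = P := by
  haveI := numberFieldCyc ℓ K
  haveI := isCMFieldCyc ℓ h2 K
  rw [primesOver_eq_pair ℓ h2 K v P]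
  constructor
  · intro h1
    by_contra hne
    rw [Set.ncard_pair (Ne.symm hne)] at h1
    exact absurd h1 (by norm_num)
  · intro h
    rw [h, Set.pair_eq_singleton, Set.ncard_singleton]

omit hP hPv in
/-- The action of `c` through `Gal(K/ℚ)` and through `Gal(K/K⁺)` on ideals of `𝓞_K` agree. -/
theorem restrictScalars_smul_eq [NumberField K] [IsCMField K] :
    (complexConj K).restrictScalars ℚ • P = complexConj K • P := by
  rw [Ideal.pointwise_smul_def, Ideal.pointwise_smul_def]
  rfl

end Primes

section Main

variable (ℓ : ℕ) [hℓ : Fact ℓ.Prime] (h2 : 2 < ℓ)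
variable (K : Type*) [Field K] [CharZero K] [IsCyclotomicExtension {ℓ} ℚ K]
variable (p : ℕ) [hp : Fact p.Prime] (hn : p.Coprime ℓ)
variable (v : HeightOneSpectrum (𝓞 (maximalRealSubfield K))) [hv : v.asIdeal.LiesOver (Ideal.span {(p : ℤ)})]
include h2 hn hv

/-- **A PLACE OF `ℚ(ζ_ℓ)⁺` ABOVE `p ≠ ℓ` HAS ONE PRIME OF `ℚ(ζ_ℓ)` ABOVE IT IFF `orderOf (p mod ℓ)` IS EVEN.** -/
theorem ncard_primesOver_eq_one_iff_even :
    haveI := numberFieldCyc ℓ K; haveI := isCMFieldCyc ℓ h2 K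
    (v.asIdeal.primesOver (𝓞 K)).ncard = 1 ↔ Even (orderOf (p : ZMod ℓ)) := by
  haveI := numberFieldCyc ℓ K
  haveI := isCMFieldCyc ℓ h2 K
  obtain ⟨⟨P, hP, hPo⟩⟩ := Ideal.nonempty_primesOver (S := 𝓞 K) v.asIdeal
  haveI := hP
  haveI := hPo
  haveI : P.IsMaximal := hP.isMaximal (Ideal.ne_bot_of_liesOver_of_ne_bot v.ne_bot P)
  haveI : P.LiesOver (Ideal.span {(p : ℤ)}) := Ideal.LiesOver.trans P v.asIdeal _
  rw [ncard_primesOver_eq_one_iff_smul_eq ℓ h2 K v P, ← restrictScalars_smul_eq K P, ← mem_stabilizer_iff,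
    complexConj_mem_stabilizer_iff ℓ h2 K p hn P]

omit h2 in
/-- `e(w/v) = 1` for `p ≠ ℓ` (the tower law with `e(w/p) = 1`). -/
theorem ramificationIdx_over_eq_one (w : HeightOneSpectrum (𝓞 K)) [hw : w.asIdeal.LiesOver v.asIdeal] :
    haveI := numberFieldCyc ℓ K
    w.asIdeal.ramificationIdx (𝓞 (maximalRealSubfield K)) = 1 := by
  haveI := numberFieldCyc ℓ K
  haveI : w.asIdeal.LiesOver (Ideal.span {(p : ℤ)}) := Ideal.LiesOver.trans w.asIdeal v.asIdeal _
  have htower := Ideal.ramificationIdx_tower (R := ℤ) v.asIdeal w.asIdeal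
  rw [IsCyclotomicExtension.Rat.ramificationIdx_eq_of_not_dvd (m := ℓ) p K w.asIdeal
    ((Nat.Prime.coprime_iff_not_dvd hp.out).mp hn)] at htower
  exact Nat.eq_one_of_mul_eq_one_left htower.symm

/-- **A PLACE `v` OF `ℚ(ζ_ℓ)⁺` ABOVE `p ≠ ℓ` STAYS PRIME IN `ℚ(ζ_ℓ)` (`v 𝓞_K = w`) IFF `orderOf (p mod ℓ)` IS EVEN** —
the general form of file 266's census, for every odd prime `ℓ`. -/
theorem exists_map_eq_iff_even :
    haveI := numberFieldCyc ℓ K; haveI := isCMFieldCyc ℓ h2 K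
    (∃ w : HeightOneSpectrum (𝓞 K),
      Ideal.map (algebraMap (𝓞 (maximalRealSubfield K)) (𝓞 K)) v.asIdeal = w.asIdeal) ↔
      Even (orderOf (p : ZMod ℓ)) := by
  haveI := numberFieldCyc ℓ K
  haveI := isCMFieldCyc ℓ h2 K
  rw [← ncard_primesOver_eq_one_iff_even ℓ h2 K p hn v]
  constructor
  · rintro ⟨w, hw⟩
    haveI := liesOver_of_map_eq K v w hw
    exact ncard_primesOver_eq_one_of_staysPrime K v w hw
  · intro h1
    obtain ⟨⟨P, hP, hPo⟩⟩ := Ideal.nonempty_primesOver (S := 𝓞 K) v.asIdeal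
    haveI := hP
    haveI := hPo
    refine ⟨⟨P, hP, Ideal.ne_bot_of_liesOver_of_ne_bot v.ne_bot P⟩,
      map_eq_of_ramificationIdx'_eq_one_of_ncard_primesOver_eq_one K v
        ⟨P, hP, Ideal.ne_bot_of_liesOver_of_ne_bot v.ne_bot P⟩ ?_ h1⟩
    rw [Ideal.ramificationIdx'_eq_ramificationIdx v.asIdeal P v.ne_bot]
    exact ramificationIdx_over_eq_one ℓ K p hn v ⟨P, hP, Ideal.ne_bot_of_liesOver_of_ne_bot v.ne_bot P⟩
      (hw := hPo)

/-- **TWO primes of `ℚ(ζ_ℓ)` above `v` iff `orderOf (p mod ℓ)` is odd.** -/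
theorem ncard_primesOver_eq_two_iff_odd :
    haveI := numberFieldCyc ℓ K; haveI := isCMFieldCyc ℓ h2 K
    (v.asIdeal.primesOver (𝓞 K)).ncard = 2 ↔ Odd (orderOf (p : ZMod ℓ)) := by
  haveI := numberFieldCyc ℓ K
  haveI := isCMFieldCyc ℓ h2 K
  rw [← Nat.not_even_iff_odd, ← ncard_primesOver_eq_one_iff_even ℓ h2 K p hn v]
  rcases ncard_primesOver_eq_one_or_two K v with h | h <;> rw [h] <;> norm_num

end Main

end Summit.Ventures.HodgeRepro2.T5CyclotomicStaysPrimeIffEven
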